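import Mathlib
import Summits.Ventures.PercRepro2.K5StarAll
import Summits.Ventures.PercRepro2.K5StarGenMain
import Summits.Ventures.PercRepro2.TypedBundleCutRoots
import Summits.Ventures.PercRepro2.TypedResidualSeven
import Summits.Ventures.PercRepro2.TypedTwoTerminalFull

/-!
# The typed residual closures without their star hypotheses (blind cell PercRepro2, typer-1 g55)

The closures of the typed lane `HCov_all_of_residualCoreFull_all`, `…FullTB_all`, `…FullT_all`,
`…Full7_all'` (p2 / p3, TypedBundleCutRoots / TypedResidualSeven / TypedTwoTerminalFull) take the
two `K₅` certificate bundles as named hypotheses `(h3 : StarCerts R) (h4 : StarCertsGen R)`. Both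
are theorems of the tree — `K5.starCerts_holds` (p2, K5StarAll) and `K5.starCertsGen_holds`
(mine-2 g41, K5StarGenMain p700801) — so each closure holds UNCONDITIONALLY (mine-2 g41's pointer
at its SEAT CLOSE, STATUS 11391: «one line each»):

* **`HCov_all_of_residualCoreFull_all''`**, **`HCov_all_of_residualCoreFullTB_all''`**,
  **`HCov_all_of_residualCoreFullT_all''`**, **`HCov_all_of_residualCoreFull7_all''`** — the crux
  from (TRI) on the respective typed residual class, no hypothesis.
-/

namespace Summit.Ventures.PercRepro2

namespace CovForm.TypedRed

section Unconditional

variable (R : Type*) [Field R] [LinearOrder R] [IsStrictOrderedRing R]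

/-- **The crux from (TRI) on `ResidualCoreFull`, unconditionally.** -/
theorem HCov_all_of_residualCoreFull_all'' (hc : ResidualCoreFull_all R) : HCov_all R :=
  HCov_all_of_residualCoreFull_all R (K5.starCerts_holds R) K5.starCertsGen_holds hc

/-- **The crux from (TRI) on `ResidualCoreFullTB`, unconditionally.** -/
theorem HCov_all_of_residualCoreFullTB_all'' (hc : ResidualCoreFullTB_all R) : HCov_all R :=
  HCov_all_of_residualCoreFullTB_all R (K5.starCerts_holds R) K5.starCertsGen_holds hc

/-- **The crux from (TRI) on `ResidualCoreFullT`, unconditionally.** -/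
theorem HCov_all_of_residualCoreFullT_all'' (hc : ResidualCoreFullT_all R) : HCov_all R :=
  HCov_all_of_residualCoreFullT_all R (K5.starCerts_holds R) K5.starCertsGen_holds hc

/-- **The crux from (TRI) on `ResidualCoreFull7`, unconditionally.** -/
theorem HCov_all_of_residualCoreFull7_all'' (hc : ResidualCoreFull7_all R) : HCov_all R :=
  HCov_all_of_residualCoreFull7_all' R (K5.starCerts_holds R) K5.starCertsGen_holds hc

end Unconditional

end CovForm.TypedRed

end Summit.Ventures.PercRepro2
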